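import Summits.CriticalPhenomena.PercolationContinuityZ3.Theorems.SahiAEOpenBandFamily

/-!
# Open bands in every dimension: the separable correction read off the family lines

Support file of the Sahi cell (`prim-sahi`, typer seat, generation 25; `--supports stmt-CriticalPhenomena-4575`).
Small definitions (`gSel`, `gIdx`, `lineValue`, `lineSum`), theorems otherwise; no named facts, no sorries.

Let `U ⊆ ℝ^ι` be an open band, `φ : ℝ^ι → ℝ` measurable and `c : ℕ → U` a family of base points (in the
application: the dense generic family of `exists_openBand_seq`).  For each coordinate `i` and height `t`,
`gIdx U c i t` is the first index `k` whose `i`-line through `c_k` passes ROBUSTLY through `U` at height `t` (at the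
heights `t` and `t + r_k`, `r_k = 1/(k+1)`; `0` if no line does), `lineValue U φ c i t = φ(c_k; i := t)` the value
of `φ` read on that line, and

  `lineSum U φ c x = Σᵢ lineValue U φ c i xᵢ`

— a MODULAR Borel function (`lineSum_modular`, `measurable_lineSum` via `Measurable.find`).  Near every robust height
`t₀` the selected index is constant from the left and its line runs in `U` ACROSS `t₀` (`exists_gIdx_eq_left`: the
one-sided dichotomy for order-convex sections of `SahiAEOpenBand.lean`; robustness keeps the selected line away from
its exit height), so that from the lower-left `lineSum` reads `φ` on FIXED family lines through `U`
(`exists_lineValue_eq_left`).  Subtracting `lineSum` removes the non-regular modular part of `φ`: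
`SahiAEOpenBandRegularity.lean`.  No sorries, no new axioms.
-/

noncomputable section

namespace Summit.CriticalPhenomena.PercolationContinuityZ3.Theorems.SahiAEFourFunctions

open MeasureTheory Set Filter Topology Function Metric
open scoped ENNReal NNReal

variable {ι : Type*} [Fintype ι] [DecidableEq ι]

/-! ### The separable correction read off the family lines -/

omit [Fintype ι] in
/-- The selection event in direction `i` at height `t` for the index `k`: either NO family line passes robustly
through `U` at height `t` (robustly for `c_m`: at the heights `t` and `t + r_m`, `r_m = 1/(m+1)`), or the line of
`c_k` does. [this work] -/
def gSel (U : Set (ι → ℝ)) (c : ℕ → ι → ℝ) (i : ι) (k : ℕ) (t : ℝ) : Prop :=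
  (∀ m, ¬(update (c m) i t ∈ U ∧ update (c m) i (t + cornerRadius m) ∈ U)) ∨
    (update (c k) i t ∈ U ∧ update (c k) i (t + cornerRadius k) ∈ U)

omit [Fintype ι] in
/-- The selection event happens for some index. [folklore] -/
theorem exists_gSel (U : Set (ι → ℝ)) (c : ℕ → ι → ℝ) (i : ι) (t : ℝ) : ∃ k, gSel U c i k t := by
  by_cases h : ∃ m, update (c m) i t ∈ U ∧ update (c m) i (t + cornerRadius m) ∈ U
  · obtain ⟨m, hm⟩ := h; exact ⟨m, Or.inr hm⟩
  · push Not at h; exact ⟨0, Or.inl fun m hm => h m hm.1 hm.2⟩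

open Classical in
omit [Fintype ι] in
/-- **The selected index** in direction `i` at height `t`: the first `k` whose `i`-line through `c_k` passes
robustly through `U` at height `t` (`0` if none does). [this work] -/
def gIdx (U : Set (ι → ℝ)) (c : ℕ → ι → ℝ) (i : ι) (t : ℝ) : ℕ := Nat.find (exists_gSel U c i t)

omit [Fintype ι] in
/-- **The line value** `lineValue U φ c i t = φ(c_k; i := t)`, `k` the selected index: the value of `φ` read on
the first family line passing robustly through `U` at height `t`. [this work] -/
def lineValue (U : Set (ι → ℝ)) (φ : (ι → ℝ) → ℝ) (c : ℕ → ι → ℝ) (i : ι) (t : ℝ) : ℝ :=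
  φ (update (c (gIdx U c i t)) i t)

/-- **The separable correction** `lineSum U φ c x = Σᵢ lineValue U φ c i xᵢ`. [this work] -/
def lineSum (U : Set (ι → ℝ)) (φ : (ι → ℝ) → ℝ) (c : ℕ → ι → ℝ) (x : ι → ℝ) : ℝ :=
  ∑ i, lineValue U φ c i (x i)

omit [Fintype ι] in
/-- **The robust height set** of the member `c_k` in direction `i`: the heights `t` at which its `i`-line passes
through `U` both at `t` and at `t + r_k`. [this work] -/
def robustSet (U : Set (ι → ℝ)) (c : ℕ → ι → ℝ) (i : ι) (k : ℕ) : Set ℝ :=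
  {t : ℝ | update (c k) i t ∈ U ∧ update (c k) i (t + cornerRadius k) ∈ U}

omit [Fintype ι] in
/-- Membership in the robust height set. [folklore] -/
theorem mem_robustSet {U : Set (ι → ℝ)} {c : ℕ → ι → ℝ} {i : ι} {k : ℕ} {t : ℝ} :
    t ∈ robustSet U c i k ↔ update (c k) i t ∈ U ∧ update (c k) i (t + cornerRadius k) ∈ U := Iff.rfl

omit [Fintype ι] in
/-- The robust line events are measurable (for open `U`). [folklore] -/
theorem measurableSet_robust {U : Set (ι → ℝ)} (hUo : IsOpen U) (c : ℕ → ι → ℝ) (i : ι) (m : ℕ) :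
    MeasurableSet {t : ℝ | update (c m) i t ∈ U ∧ update (c m) i (t + cornerRadius m) ∈ U} :=
  (isOpen_lineSection hUo (c m) i).measurableSet.inter
    (((isOpen_lineSection hUo (c m) i).preimage (continuous_id.add continuous_const)).measurableSet)

omit [Fintype ι] in
/-- The selection events are measurable (for open `U`). [folklore] -/
theorem measurableSet_gSel {U : Set (ι → ℝ)} (hUo : IsOpen U) (c : ℕ → ι → ℝ) (i : ι) (k : ℕ) :
    MeasurableSet {t | gSel U c i k t} := by
  have e : {t | gSel U c i k t} =
      (⋂ m, {t : ℝ | update (c m) i t ∈ U ∧ update (c m) i (t + cornerRadius m) ∈ U}ᶜ) ∪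
        {t : ℝ | update (c k) i t ∈ U ∧ update (c k) i (t + cornerRadius k) ∈ U} := by
    ext t
    simp only [gSel, Set.mem_setOf_eq, Set.mem_union, Set.mem_iInter, Set.mem_compl_iff]
  rw [e]
  exact (MeasurableSet.iInter fun m => (measurableSet_robust hUo c i m).compl).union (measurableSet_robust hUo c i k)

omit [Fintype ι] in
/-- **The line values are Borel** in the height (`Measurable.find`). [this work] -/
theorem measurable_lineValue {U : Set (ι → ℝ)} (hUo : IsOpen U) {φ : (ι → ℝ) → ℝ} (hφ : Measurable φ)
    (c : ℕ → ι → ℝ) (i : ι) : Measurable (lineValue U φ c i) := by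
  classical
  exact Measurable.find (fun k => hφ.comp (measurable_update (c k) (a := i)))
    (fun k => measurableSet_gSel hUo c i k) (exists_gSel U c i)

/-- **The separable correction is Borel.** [this work] -/
theorem measurable_lineSum {U : Set (ι → ℝ)} (hUo : IsOpen U) {φ : (ι → ℝ) → ℝ} (hφ : Measurable φ)
    (c : ℕ → ι → ℝ) : Measurable (lineSum U φ c) := by
  unfold lineSum
  exact Finset.measurable_sum _ fun i _ => (measurable_lineValue hUo hφ c i).comp (measurable_pi_apply i)

/-- **The separable correction is modular**: `G(x) + G(y) = G(x ∧ y) + G(x ∨ y)` for ALL `x, y`. [folklore] -/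
theorem lineSum_modular (U : Set (ι → ℝ)) (φ : (ι → ℝ) → ℝ) (c : ℕ → ι → ℝ) (x y : ι → ℝ) :
    lineSum U φ c x + lineSum U φ c y = lineSum U φ c (x ⊓ y) + lineSum U φ c (x ⊔ y) := by
  unfold lineSum
  rw [← Finset.sum_add_distrib, ← Finset.sum_add_distrib]
  refine Finset.sum_congr rfl fun i _ => ?_
  simp only [Pi.inf_apply, Pi.sup_apply]
  exact (apply_min_add_apply_max (lineValue U φ c i) (x i) (y i)).symm

omit [Fintype ι] in
/-- The robust line event of `c_m` is order-convex in the height (for an open band). [folklore] -/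
theorem IsOpenBand.ordConnected_robust {U : Set (ι → ℝ)} (hU : IsOpenBand U) (c : ℕ → ι → ℝ) (i : ι) (m : ℕ) :
    OrdConnected {t : ℝ | update (c m) i t ∈ U ∧ update (c m) i (t + cornerRadius m) ∈ U} := by
  have h1 : OrdConnected {t : ℝ | update (c m) i t ∈ U} := hU.ordConnected (c m) i
  have h2 : OrdConnected {t : ℝ | update (c m) i (t + cornerRadius m) ∈ U} := by
    refine ⟨fun s hs t ht u hu => ?_⟩
    exact h1.out hs ht ⟨by linarith [hu.1], by linarith [hu.2]⟩
  exact h1.inter h2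

omit [Fintype ι] in
/-- **The selected index is constant from the left near every robust height, and its line passes through `U`
across that height.**  If some family line passes robustly through `U` at height `t₀` in direction `i`, there are
an index `κ` and `ε > 0` such that the line of `c_κ` lies in `U` at all heights `s` with `|s − t₀| < ε`, and
`c_κ` is the selected line at every height `t ∈ (t₀ − ε, t₀)`. [this work] -/
theorem exists_gIdx_eq_left {U : Set (ι → ℝ)} (hU : IsOpenBand U) (c : ℕ → ι → ℝ) {i : ι} {t₀ : ℝ}
    (h : ∃ m, update (c m) i t₀ ∈ U ∧ update (c m) i (t₀ + cornerRadius m) ∈ U) :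
    ∃ κ, ∃ ε > 0, (∀ s, |s - t₀| < ε → update (c κ) i s ∈ U) ∧
      (∀ t ∈ Ioo (t₀ - ε) t₀, t ∈ robustSet U c i κ ∧ ∀ k < κ, t ∉ robustSet U c i k) ∧
      ∀ t ∈ Ioo (t₀ - ε) t₀, gIdx U c i t = κ := by
  classical
  set T : ℕ → Set ℝ := fun k => {t : ℝ | update (c k) i t ∈ U ∧ update (c k) i (t + cornerRadius k) ∈ U} with hT
  have hTo : ∀ k, IsOpen (T k) := fun k => (isOpen_lineSection hU.isOpen (c k) i).inter
    ((isOpen_lineSection hU.isOpen (c k) i).preimage (continuous_id.add continuous_const))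
  have hex : ∃ k, ∀ᶠ t in 𝓝[<] t₀, t ∈ T k := by
    obtain ⟨m, hm⟩ := h
    exact ⟨m, mem_nhdsWithin_of_mem_nhds ((hTo m).mem_nhds hm)⟩
  set κ := Nat.find hex with hκ
  have hκspec : ∀ᶠ t in 𝓝[<] t₀, t ∈ T κ := Nat.find_spec hex
  have hlt : ∀ k < κ, ∀ᶠ t in 𝓝[<] t₀, t ∉ T k := fun k hk =>
    (eventually_mem_or_eventually_not_mem_nhdsLT (hU.ordConnected_robust c i k) t₀).resolve_left
      (Nat.find_min hex hk)
  have hall : ∀ᶠ t in 𝓝[<] t₀, ∀ k ∈ Finset.range κ, t ∉ T k :=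
    (Finset.range κ).eventually_all.2 fun k hk => hlt k (Finset.mem_range.1 hk)
  obtain ⟨l, hl, hlsub⟩ := mem_nhdsLT_iff_exists_Ioo_subset.1 (hκspec.and hall)
  have hl' : l < t₀ := hl
  -- shrink to `ε ≤ r_κ` so that the robust event at `t₀ - ε/2` covers a neighbourhood of `t₀`
  set ε : ℝ := min (t₀ - l) (cornerRadius κ) with hε
  have hεpos : 0 < ε := lt_min (by linarith) (cornerRadius_pos κ)
  have hεl : ε ≤ t₀ - l := min_le_left _ _
  have hεr : ε ≤ cornerRadius κ := min_le_right _ _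
  have hmem : ∀ t ∈ Ioo (t₀ - ε) t₀, t ∈ T κ ∧ ∀ k ∈ Finset.range κ, t ∉ T k := fun t ht =>
    hlsub ⟨by linarith [ht.1], ht.2⟩
  refine ⟨κ, ε / 2, half_pos hεpos, fun s hs => ?_, fun t ht => ?_, fun t ht => ?_⟩
  · -- the line of `c_κ` on `[t₀ - ε/2, t₀ - ε/2 + r_κ] ⊇ (t₀ - ε/2, t₀ + ε/2)`
    have h1 := (hmem (t₀ - ε / 2) ⟨by linarith, by linarith⟩).1
    rw [abs_lt] at hs
    exact (hU.ordConnected (c κ) i).out h1.1 h1.2 ⟨by linarith, by linarith⟩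
  · obtain ⟨hTκ, hnot⟩ := hmem t ⟨by linarith [ht.1], ht.2⟩
    exact ⟨hTκ, fun k hk => hnot k (Finset.mem_range.2 hk)⟩
  · obtain ⟨hTκ, hnot⟩ := hmem t ⟨by linarith [ht.1], ht.2⟩
    rw [gIdx, Nat.find_eq_iff]
    refine ⟨Or.inr hTκ, fun k hk hsel => ?_⟩
    rcases hsel with hnone | hk'
    · exact hnone κ hTκ
    · exact hnot k (Finset.mem_range.2 hk) hk'

omit [Fintype ι] in
/-- **The line value near a robust height, from the left, is `φ` on a fixed family line through `U` across that
height.** [this work] -/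
theorem exists_lineValue_eq_left {U : Set (ι → ℝ)} (hU : IsOpenBand U) (φ : (ι → ℝ) → ℝ) (c : ℕ → ι → ℝ)
    {i : ι} {t₀ : ℝ} (h : ∃ m, update (c m) i t₀ ∈ U ∧ update (c m) i (t₀ + cornerRadius m) ∈ U) :
    ∃ κ, ∃ ε > 0, (∀ s, |s - t₀| < ε → update (c κ) i s ∈ U) ∧
      ∀ t ∈ Ioo (t₀ - ε) t₀, lineValue U φ c i t = φ (update (c κ) i t) := by
  obtain ⟨κ, ε, hε, hline, -, hidx⟩ := exists_gIdx_eq_left hU c h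
  exact ⟨κ, ε, hε, hline, fun t ht => by rw [lineValue, hidx t ht]⟩

end Summit.CriticalPhenomena.PercolationContinuityZ3.Theorems.SahiAEFourFunctions
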